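/-
COR-CM (cell pub-hodgecm2, stage 2 of the Hodge ladder) — count-neutral KERNEL COMBINATORICS «β − 2 generating rank-four faces for every Galois CM field of
twist type ℤ/2n × B with a screw, all n ≥ 2 at once; the complete count at every 2-power level» (seat prover-pub-hodgecm2-b09-g37-0, binder prover b09,
gen 37; claim UNIFORM SCREW LAW, HOME/INBOX.md l.17696 / INTERIM #1 l.17845).  Theorems only; no geometry beyond the tree's `Face` / `faceOfG`, no `Universe`
field touched, no named fact, nothing asserted; this seat's uniform screw law (`Census/TwistScrewLaw.lean`), its uniform law (`Census/TwistGeneration*`,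
`CorCM/FaceTwistGeneration.lean`) and seat b23's generic transfer (`CorCM/FaceGenerationTransfer.lean`) are used BY NAME; `Interfaces.lean` (C1), every
E term, B01, `Transposition/*`, `PortJoin/*`, `D2Bridge/*` are untouched.
HONEST FRAMING (COORDINATOR RULING — HODGE FRAMING CORRECTION, 2026-08-21T11:55:35Z): `HC_CM` is NOT proved, here or anywhere in the tree; this file
produces no period and proves no face period for any field.
T5: n/a-class — the only Prop hypothesis binders displayed are the datum equations (`θ (P * Q) = θ P + θ Q`, `θ conjT = (n, 0)`), `2 ≤ n`, `3 ≤ |B|`,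
`n = 2^j` and the order condition on `B`, INT2-GEN's `hgen` in the floor statements and INT2-GEN's period hypothesis on the produced face set (§3);
no named-fact / conjecture-def binder; checker: self
(prover-pub-hodgecm2-b09-g37-0), 2026-08-24.
-/
import Summits.HodgeConjecture.CorCM.Census.TwistScrewLaw
import Summits.HodgeConjecture.CorCM.FaceTwistGeneration
import HarnessLib

/-!
# Galois CM fields of twist type `ℤ/2n × B` WITH A SCREW: `β − 2` generating rank-four faces for EVERY `n ≥ 2`, exactly `β − 2` at the levels `2^j`,
# and the complete count `β − 1 − [∃ t ∈ B, 2n ∣ ord t]`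

Let `F` be a Galois CM field with a TWIST DATUM of level `n ≥ 2`: `θ : GalT F ≃ ZMod (2n) × B`, multiplicative-to-additive, `θ conjT = (n, 0)`
(`Gal(F/ℚ) = ⟨u⟩ × B`, `u` central of order `2n`, `uⁿ =` complex conjugation; `B` ANY finite group).  `CorCM/FaceTwistGeneration.lean` (this seat, gen 36) gave
`β(F) − 1` generating faces for every such field and the exact count `β(F) − 1` when `B` has no element of order divisible by `2n` (`n = 2^j`), leaving the
sandwich `β − 2 ≤ · ≤ β − 1` in the SCREW case (`∃ t ∈ B, 2n ∣ ord t` — e.g. `F = k_{2^{j+1}}·L` with `Gal(L/ℚ) = B ∋` an element of order divisible by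
`2^{j+1}`; the smallest Galois groups are `ℤ/2^{j+1} × ℤ/2^{j+1}`, degree `4^{j+1}`).  This file closes it:

* §1 **`exists_faces_hgen_of_twist_screw`** (every `n ≥ 2`, some `t ∈ B` with `2n ∣ ord t`): for every base embedding `σ₀` a finite set `𝒮` of rank-four
  faces with **`|𝒮| + 2 ≤ β(F)`** and `hgen(𝒮, σ₀)` — the field form of `Census.TwistGeneration.exists_gfaces_generate_screw`.
* §2 (`n = 2^j`) **`isLeast_card_faces_hgen_of_twist_screw`**: the least size of a face set with `hgen(𝒮, σ₀)` is EXACTLY **`β(F) − 2`**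
  (`Census.TwistGeneration.exact_law_screw` through `FaceTransfer.isLeast_card_faces_hgen_of_intrinsic`); and **THE COMPLETE COUNT**
  **`isLeast_card_faces_hgen_of_twist`**: for every `j ≥ 1` and every `B` with `|B| ≥ 3` the least size is `β(F) − 1 − [∃ t ∈ B, 2^{j+1} ∣ ord t]`
  (`Census.TwistGeneration.complete_law`) — gen 32's GRAND CONJECTURE for every Galois CM field of abelian-normal-form twist type, in the kernel.
* §3 **`hodgeConjectureFor_of_twist_screw_of_exists_facePeriod`** (INT2-GEN socket BY NAME): a face set with `|𝒮| + 2 ≤ β(K)` EXISTS whose periods on the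
  universe of record give the Hodge conjecture for every abelian variety dominated by a product of CM abelian varieties with CM by subfields of `K` —
  CONDITIONAL on those periods; `HC_CM` is NOT proved.

References: [cite: Pohlmann1968, Thm. 1]; [cite: Milne1999LefschetzClasses, Thm. 3.2, Prop. 2.1]; [cite: Shimura1998, §6.2 Theorem 3 and §6.1
Corollary of Theorem 2 (pp. 41–43), §8.1 (p. 62)]; [cite: MumfordAV1970, §19 Thm. 1 and p. 169].
-/

noncomputable section

open CategoryTheory NumberField NumberField.ComplexEmbedding
open Literature.AlgebraicGeometry Literature.AlgebraicGeometry.Motives Literature.AlgebraicGeometry.HodgeTheory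
open Literature.AlgebraicGeometry.ComplexMultiplication Literature.AlgebraicGeometry.Milne1999
open Literature.NumberTheory.Automorphic
open Literature.NumberTheory.Automorphic.PicardCM
open Summit.HodgeConjecture.CorCM.Domination

namespace Summit.HodgeConjecture.CorCM.FaceTwist

open Summit.HodgeConjecture.CorCM.Prior.AllgGroup.RfwfAllgGroup
open Summit.HodgeConjecture.CorCM.Census.BlockParity
open Summit.HodgeConjecture.CorCM.Census.Coinvariant
open Summit.HodgeConjecture.CorCM.Census

variable {F : Type} [Field F] [NumberField F]
variable {B : Type} [AddGroup B] [Fintype B] [DecidableEq B]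
variable {n : ℕ} [NeZero n]

/-! ## §1 Every level `n ≥ 2` with a screw: `β(F) − 2` generating faces -/

/-- **EVERY GALOIS CM FIELD OF TWIST TYPE `ℤ/2n × B` WITH A SCREW HAS AT MOST `β − 2` GENERATING FACES.**  For `F` Galois CM with a twist datum
`θ : GalT F ≃ ZMod (2n) × B` (`n ≥ 2`), some `t ∈ B` of additive order divisible by `2n`, and any base embedding `σ₀`: a finite set `𝒮` of rank-four faces
with `|𝒮| + 2 ≤ β(F) = #Block conjT` and `hgen(𝒮, σ₀)`. [folklore] -/
theorem exists_faces_hgen_of_twist_screw [IsCMField F] [IsGalois ℚ F] (θ : GalT F ≃ ZMod (2 * n) × B)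
    (hθ : ∀ P Q : GalT F, θ (P * Q) = θ P + θ Q) (hθc : θ conjT = (((n : ℕ) : ZMod (2 * n)), 0)) (hn : 2 ≤ n)
    (hs : ∃ t : B, 2 * n ∣ addOrderOf t) (σ₀ : F →+* ℂ) :
    ∃ 𝒮 : Finset (Face F), 𝒮.card + 2 ≤ Fintype.card (Block (conjT : GalT F)) ∧
      ∀ f : Face F, lefChar f.corner (fun _ => ({σ₀} : Finset (F →+* ℂ))) ∈ AddSubgroup.closure
        {a : Asym F | ∃ g ∈ (𝒮 : Set (Face F)), ∃ σ : F →+* ℂ, a = lefChar g.corner (fun _ => ({σ} : Finset (F →+* ℂ)))} := by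
  obtain ⟨S, hS, hcard, hgenr⟩ := TwistGeneration.exists_gfaces_generate_screw θ hθ hθc conjT_mul_self hn hs
  obtain ⟨𝒮, h𝒮card, hgen⟩ := FaceTransfer.exists_faces_hgen_of_generate σ₀ S hS hgenr
  exact ⟨𝒮, by omega, hgen⟩

/-! ## §2 The levels `n = 2^j`: exactly `β(F) − 2` with a screw; the complete count -/

/-- **SCREW: EXACTLY `β(F) − 2` GENERATING FACES.**  `n = 2^j ≥ 2`, some element of `B` of additive order divisible by `2n`: the least size of a face set `𝒮`
with `hgen(𝒮, σ₀)` is EXACTLY `β(F) − 2`, for every base embedding `σ₀`. [folklore] -/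
theorem isLeast_card_faces_hgen_of_twist_screw [IsCMField F] [IsGalois ℚ F] (θ : GalT F ≃ ZMod (2 * n) × B)
    (hθ : ∀ P Q : GalT F, θ (P * Q) = θ P + θ Q) (hθc : θ conjT = (((n : ℕ) : ZMod (2 * n)), 0)) {j : ℕ} (hj : n = 2 ^ j) (hn : 2 ≤ n)
    (hs : ∃ t : B, 2 * n ∣ addOrderOf t) (σ₀ : F →+* ℂ) :
    IsLeast {m : ℕ | ∃ 𝒮 : Finset (Face F), 𝒮.card = m ∧
      ∀ f : Face F, lefChar f.corner (fun _ => ({σ₀} : Finset (F →+* ℂ))) ∈ AddSubgroup.closure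
        {a : Asym F | ∃ g ∈ (𝒮 : Set (Face F)), ∃ σ : F →+* ℂ, a = lefChar g.corner (fun _ => ({σ} : Finset (F →+* ℂ)))}}
      (Fintype.card (Block (conjT : GalT F)) - 2) := by
  obtain ⟨⟨S, hS, hcard, hgenr⟩, hfloor⟩ := TwistGeneration.exact_law_screw θ hθ hθc conjT_mul_self hj hn hs
  refine FaceTransfer.isLeast_card_faces_hgen_of_intrinsic _ ⟨S, hS, by omega, hgenr⟩ (fun S₀ hS₀ hgen₀ => ?_) σ₀
  have h := hfloor S₀ hS₀ fun y hy => hgen₀ (gfaceSet_subset_hodgeSpan _ _ hy)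
  omega

/-- **Existence with the exact count, screw case**: a face set `𝒮` with `|𝒮| + 2 = β(F)` and `hgen(𝒮, σ₀)`. [folklore] -/
theorem exists_faces_hgen_card_of_twist_screw [IsCMField F] [IsGalois ℚ F] (θ : GalT F ≃ ZMod (2 * n) × B)
    (hθ : ∀ P Q : GalT F, θ (P * Q) = θ P + θ Q) (hθc : θ conjT = (((n : ℕ) : ZMod (2 * n)), 0)) {j : ℕ} (hj : n = 2 ^ j) (hn : 2 ≤ n)
    (hs : ∃ t : B, 2 * n ∣ addOrderOf t) (σ₀ : F →+* ℂ) :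
    ∃ 𝒮 : Finset (Face F), 𝒮.card + 2 = Fintype.card (Block (conjT : GalT F)) ∧
      ∀ f : Face F, lefChar f.corner (fun _ => ({σ₀} : Finset (F →+* ℂ))) ∈ AddSubgroup.closure
        {a : Asym F | ∃ g ∈ (𝒮 : Set (Face F)), ∃ σ : F →+* ℂ, a = lefChar g.corner (fun _ => ({σ} : Finset (F →+* ℂ)))} := by
  obtain ⟨⟨𝒮, hcard, hgen⟩, -⟩ := isLeast_card_faces_hgen_of_twist_screw θ hθ hθc hj hn hs σ₀
  obtain ⟨S, -, hS, -⟩ := TwistGeneration.exists_gfaces_generate_screw θ hθ hθc conjT_mul_self hn hs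
  exact ⟨𝒮, by omega, hgen⟩

open Classical in
/-- **THE COMPLETE COUNT FOR GALOIS CM FIELDS OF TWIST TYPE `ℤ/2^{j+1} × B`.**  `n = 2^j ≥ 2`, `|B| ≥ 3`: for every base embedding `σ₀`, the least size of a
face set `𝒮` with `hgen(𝒮, σ₀)` is EXACTLY `β(F) − 1 − [∃ t ∈ B, 2n ∣ ord t]` — gen 32's GRAND CONJECTURE, both halves, every level. [folklore] -/
theorem isLeast_card_faces_hgen_of_twist [IsCMField F] [IsGalois ℚ F] (θ : GalT F ≃ ZMod (2 * n) × B)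
    (hθ : ∀ P Q : GalT F, θ (P * Q) = θ P + θ Q) (hθc : θ conjT = (((n : ℕ) : ZMod (2 * n)), 0)) {j : ℕ} (hj : n = 2 ^ j) (hn : 2 ≤ n)
    (h3 : 3 ≤ Fintype.card B) (σ₀ : F →+* ℂ) :
    IsLeast {m : ℕ | ∃ 𝒮 : Finset (Face F), 𝒮.card = m ∧
      ∀ f : Face F, lefChar f.corner (fun _ => ({σ₀} : Finset (F →+* ℂ))) ∈ AddSubgroup.closure
        {a : Asym F | ∃ g ∈ (𝒮 : Set (Face F)), ∃ σ : F →+* ℂ, a = lefChar g.corner (fun _ => ({σ} : Finset (F →+* ℂ)))}}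
      (Fintype.card (Block (conjT : GalT F)) - (if ∃ t : B, 2 * n ∣ addOrderOf t then 2 else 1)) := by
  by_cases hs : ∃ t : B, 2 * n ∣ addOrderOf t
  · rw [if_pos hs]; exact isLeast_card_faces_hgen_of_twist_screw θ hθ hθc hj hn hs σ₀
  · rw [if_neg hs]; exact isLeast_card_faces_hgen_of_twist_noScrew θ hθ hθc hj hn h3 (fun b hb => hs ⟨b, hb⟩) σ₀

/-! ## §3 The Hodge-conjecture reading through the INT2-GEN socket (conditional on the face periods) -/

/-- **HC for the slice of a Galois CM field of twist type with a screw from `β − 2` face periods** (INT2-GEN socket BY NAME; CONDITIONAL on the periods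
— `HC_CM` is NOT proved): for `K` Galois CM with a twist datum `θ : GalT K ≃ ZMod (2n) × B` (`n ≥ 2`) and some `t ∈ B` of order divisible by `2n` there is a
face set `𝒮` with `|𝒮| + 2 ≤ β(K)` such that, if every face of `𝒮` has a non-vanishing period on the universe of record, the Hodge conjecture holds for every
abelian variety dominated by a product of CM abelian varieties with CM by subfields of `K`.
[cite: Shimura1998, §6.2 Theorem 3 and §6.1 Corollary of Theorem 2 (pp. 41–43)] [cite: Pohlmann1968, Thm. 1]
[cite: Milne1999LefschetzClasses, Thm. 3.2 and Cor. 4.5] [cite: MumfordAV1970, §19 Thm. 1 and p. 169] -/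
theorem hodgeConjectureFor_of_twist_screw_of_exists_facePeriod (K : CMField) [hGal : IsGalois ℚ K] (θ : GalT K ≃ ZMod (2 * n) × B)
    (hθ : ∀ P Q : GalT K, θ (P * Q) = θ P + θ Q) (hθc : θ conjT = (((n : ℕ) : ZMod (2 * n)), 0)) (hn : 2 ≤ n)
    (hs : ∃ t : B, 2 * n ∣ addOrderOf t) (σ₀ : (K : Type) →+* ℂ) :
    ∃ 𝒮 : Finset (Face K), 𝒮.card + 2 ≤ Fintype.card (Block (conjT : GalT K)) ∧
      ((∀ f ∈ 𝒮, ∃ ι₁ : K →+* ℂ, f.Admissible ι₁ ∧ ∃ (V : HermSpace3 K ι₁) (σ : K →+* ℂ),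
        (Model.picardCMUniverse exists_isReal_hodgeModel_holds hodgePQ_independent_of_hodgeModel_holds
          BallQuotient.ballQuotientUniformised_holds cmAbelianVarietyRealised_holds).PeriodNV ι₁ V K f.psi σ) →
      ∀ {P A : AbelianVariety ℂ}, AbelianVariety.IsProductOf (fun A : AbelianVariety ℂ =>
        ∃ (E : Type) (_ : Field E) (_ : NumberField E) (_ : IsCMField E) (_ : E →+* (K : Type)) (Φ : CMType E)
          (ι : 𝓞 E →+* End A) (ϑ : E →+* Module.End ℂ (complexBetti A.X 1)),
          IsCMTypeRealisation Φ A ι ϑ) P →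
      AVDominatedBy A P → HodgeConjectureFor A.dim A.X) := by
  obtain ⟨t, ht⟩ := hs
  have h3 : 3 ≤ Fintype.card B := TwistGeneration.three_le_card_of_dvd_addOrderOf hn ht
  obtain ⟨𝒮, hcard, hgen⟩ := exists_faces_hgen_of_twist_screw (F := K) θ hθ hθc hn ⟨t, ht⟩ σ₀
  refine ⟨𝒮, hcard, fun h P A hP hA => ?_⟩
  exact hodgeConjectureFor_of_avDominatedBy_isProductOf_of_exists_facePeriod_on K
    ((twelve_le_finrank (F := K) θ hn h3).trans' (by norm_num)) (𝒮 : Set (Face K)) σ₀ hgen (fun f hf => h f (Finset.mem_coe.mp hf)) hP hA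

end Summit.HodgeConjecture.CorCM.FaceTwist

end
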